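import Summits.QuantumFields.BalabanUV.T4Continuum.Support.ApproxRefineRegime
import HarnessLib

/-!
# T⁴ programme, node NE3 (η-rate of the minimisers) — THE ACTION SANDWICH, final assembly, part 4a:
# THE LINEAR ENVELOPE OF THE MISMATCH CONSTANT OF THE R1 END (pure real arithmetic)

NE3 prover lineage P1, gen 18 (cell `pub-balaban`, unit `b2b-balaban-t4-ne3-p1`, `HOME/BINDER-OWNERS.md` row NE3 OWNER;
skeleton `t4/b2b-balaban-t4-ne3-p1/SKELETON-NE3-P1.md` v1.5).

The owner socket `MinimalActionFinalApprox.actionRate_sfClass_of_exists_approx_linear` (part 3) takes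
`ApproxRefine d (sfClass …) L N b c b₁ c₁ m` with LINEAR bounds `b ≤ t`, `b₁ ≤ K·t`, `m ≤ K·t`.  For the crew's R1 END
(`ApproxRefineEnd.approxRefine_sfClass`, leaf-09 g2 part 3c, constants `b₁ = 4A + 48dL²G₀ + 128(2d+1)²L²A²`,
`c₁ = L³(32dA(4A + r + 12G₀) + 4r + 24G₀)`, `m = 3(1280d(d+1)²(d+4)²L²b₁² + d(d+1)c₁ + (d−1)²(c + (37(d−1)+4)b²))`,
`A = (8d−7)b`, `G₀ = (2d−1)c + gradRem(d)b²`, `r = 24dG₀ + 224(d+1)²A²`) the crew's `ApproxRefineRegime` (p213660) gives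
`b₁ ≤ K_b·t` (`fillRadius_le_of_small`) and `c₁ ≤ K_c·t` (`gradRadius_le_of_small`) for `0 ≤ b ≤ t ≤ 1`, `0 ≤ c ≤ t`.
THIS FILE adds the two missing pieces (0 def, 0 sorry, [folklore] arithmetic): `fillRadius_nonneg`, `mismatch_nonneg`, and
**`mismatch_le_of_small`**: `m ≤ K_m·t` with
`K_m = 3(1280d(d+1)²(d+4)²L²·K_b² + d(d+1)·K_c + (d−1)²(37(d−1)+5))` — so `K := K_b + K_m` serves the socket.

HONEST FRAMING.  Arithmetic bookkeeping; **NE3 is NOT proved**; nothing printed is a hypothesis; no conditional of the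
cell (`BetaPertH`, (B), (B^μ), G-an2-4) occurs; no `def`, no `sorry`, axioms ⊆ {propext, Classical.choice, Quot.sound}.
Finite T⁴ rung (B)+1 — NOT infinite volume, NOT a mass gap, NOT the Clay problem, NOT summit progress.  PLACEMENT (human
rule 2026-08-19): `Summits/QuantumFields/BalabanUV/`.  HONEST DEPENDENCY (cell page 1): continuum YM on T⁴ ⇐ BetaPertH ∧
nine spine estimates (0/9 proved); BetaPertH ⇐ (D1) ∧ (D4) ∧ CAP+tail; G-an2-4 gates asym, D1 and NE2/3/4.
-/

set_option autoImplicit false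

namespace Summit.QuantumFields.BalabanUV.T4Continuum.MinimalActionMismatchSmall

open SkeletonPrecompGrad (gradRem gradRem_nonneg)
open ApproxRefineRegime

noncomputable section

variable {d : ℕ}

/-- The R1 END's small-field radius `b₁ = 4A + 48dL²G₀ + 128(2d+1)²L²A²` is nonnegative (`d ≥ 1`, `b, c ≥ 0`). [folklore] -/
theorem fillRadius_nonneg (hd : 1 ≤ d) (L : ℕ) {b c : ℝ} (hb : 0 ≤ b) (hc : 0 ≤ c) :
    0 ≤ 4 * (8 * (d : ℝ) - 7) * b + 48 * d * (L : ℝ) ^ 2 * ((2 * (d : ℝ) - 1) * c + gradRem d * b ^ 2)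
        + 128 * (2 * (d : ℝ) + 1) ^ 2 * (L : ℝ) ^ 2 * ((8 * (d : ℝ) - 7) * b) ^ 2 := by
  have hd1 : (1 : ℝ) ≤ d := by exact_mod_cast hd
  have h87 : 0 ≤ 8 * (d : ℝ) - 7 := by linarith
  have h21 : 0 ≤ 2 * (d : ℝ) - 1 := by linarith
  have hΓ := gradRem_nonneg hd
  positivity

/-- The R1 END's mismatch constant `m = 3(1280d(d+1)²(d+4)²L²b₁² + d(d+1)c₁ + (d−1)²(c + (37(d−1)+4)b²))` is nonnegative
(`d ≥ 1`, `b, c ≥ 0`). [folklore] -/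
theorem mismatch_nonneg (hd : 1 ≤ d) (L : ℕ) {b c : ℝ} (hb : 0 ≤ b) (hc : 0 ≤ c) :
    0 ≤ 3 * (1280 * d * ((d : ℝ) + 1) ^ 2 * ((d : ℝ) + 4) ^ 2 * (L : ℝ) ^ 2
          * (4 * (8 * (d : ℝ) - 7) * b + 48 * d * (L : ℝ) ^ 2 * ((2 * (d : ℝ) - 1) * c + gradRem d * b ^ 2)
            + 128 * (2 * (d : ℝ) + 1) ^ 2 * (L : ℝ) ^ 2 * ((8 * (d : ℝ) - 7) * b) ^ 2) ^ 2
        + d * ((d : ℝ) + 1) * ((L : ℝ) ^ 3 * (32 * d * ((8 * (d : ℝ) - 7) * b)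
            * (4 * ((8 * (d : ℝ) - 7) * b)
              + (24 * d * ((2 * (d : ℝ) - 1) * c + gradRem d * b ^ 2) + 224 * ((d : ℝ) + 1) ^ 2 * ((8 * (d : ℝ) - 7) * b) ^ 2)
              + 12 * ((2 * (d : ℝ) - 1) * c + gradRem d * b ^ 2))
          + 4 * (24 * d * ((2 * (d : ℝ) - 1) * c + gradRem d * b ^ 2) + 224 * ((d : ℝ) + 1) ^ 2 * ((8 * (d : ℝ) - 7) * b) ^ 2)
          + 24 * ((2 * (d : ℝ) - 1) * c + gradRem d * b ^ 2)))
        + ((d : ℝ) - 1) ^ 2 * (c + (37 * ((d : ℝ) - 1) + 4) * b ^ 2)) := by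
  have hd1 : (1 : ℝ) ≤ d := by exact_mod_cast hd
  have h87 : 0 ≤ 8 * (d : ℝ) - 7 := by linarith
  have h21 : 0 ≤ 2 * (d : ℝ) - 1 := by linarith
  have h37 : 0 ≤ 37 * ((d : ℝ) - 1) + 4 := by linarith
  have hΓ := gradRem_nonneg hd
  positivity

/-- **THE MISMATCH CONSTANT IS LINEARLY SMALL**: for `1 ≤ d`, `0 ≤ b ≤ t ≤ 1`, `0 ≤ c ≤ t`,
`m ≤ K_m·t`, `K_m = 3(1280d(d+1)²(d+4)²L²·K_b² + d(d+1)·K_c + (d−1)²(37(d−1)+5))` with the crew's envelopes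
`K_b = 32d + 48dL²(2d + Γ) + 8192d²(2d+1)²L²`, `K_c = L³(256d²H + 4R + 24(2d + Γ))` (`Γ = gradRem d`, `R = 24d(2d + Γ) +
14336d²(d+1)²`, `H = 32d + R + 12(2d + Γ)`). [folklore] -/
theorem mismatch_le_of_small (hd : 1 ≤ d) (L : ℕ) {b c t : ℝ} (hb : 0 ≤ b) (hc : 0 ≤ c) (hbt : b ≤ t) (hct : c ≤ t)
    (ht1 : t ≤ 1) :
    3 * (1280 * d * ((d : ℝ) + 1) ^ 2 * ((d : ℝ) + 4) ^ 2 * (L : ℝ) ^ 2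
          * (4 * (8 * (d : ℝ) - 7) * b + 48 * d * (L : ℝ) ^ 2 * ((2 * (d : ℝ) - 1) * c + gradRem d * b ^ 2)
            + 128 * (2 * (d : ℝ) + 1) ^ 2 * (L : ℝ) ^ 2 * ((8 * (d : ℝ) - 7) * b) ^ 2) ^ 2
        + d * ((d : ℝ) + 1) * ((L : ℝ) ^ 3 * (32 * d * ((8 * (d : ℝ) - 7) * b)
            * (4 * ((8 * (d : ℝ) - 7) * b)
              + (24 * d * ((2 * (d : ℝ) - 1) * c + gradRem d * b ^ 2) + 224 * ((d : ℝ) + 1) ^ 2 * ((8 * (d : ℝ) - 7) * b) ^ 2)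
              + 12 * ((2 * (d : ℝ) - 1) * c + gradRem d * b ^ 2))
          + 4 * (24 * d * ((2 * (d : ℝ) - 1) * c + gradRem d * b ^ 2) + 224 * ((d : ℝ) + 1) ^ 2 * ((8 * (d : ℝ) - 7) * b) ^ 2)
          + 24 * ((2 * (d : ℝ) - 1) * c + gradRem d * b ^ 2)))
        + ((d : ℝ) - 1) ^ 2 * (c + (37 * ((d : ℝ) - 1) + 4) * b ^ 2))
      ≤ (3 * (1280 * d * ((d : ℝ) + 1) ^ 2 * ((d : ℝ) + 4) ^ 2 * (L : ℝ) ^ 2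
            * (32 * d + 48 * d * (L : ℝ) ^ 2 * (2 * (d : ℝ) + gradRem d)
              + 8192 * (d : ℝ) ^ 2 * (2 * (d : ℝ) + 1) ^ 2 * (L : ℝ) ^ 2) ^ 2
          + d * ((d : ℝ) + 1) * ((L : ℝ) ^ 3 * (256 * (d : ℝ) ^ 2
              * (32 * d + (24 * d * (2 * (d : ℝ) + gradRem d) + 14336 * (d : ℝ) ^ 2 * ((d : ℝ) + 1) ^ 2)
                + 12 * (2 * (d : ℝ) + gradRem d))
            + 4 * (24 * d * (2 * (d : ℝ) + gradRem d) + 14336 * (d : ℝ) ^ 2 * ((d : ℝ) + 1) ^ 2)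
            + 24 * (2 * (d : ℝ) + gradRem d)))
          + ((d : ℝ) - 1) ^ 2 * (37 * ((d : ℝ) - 1) + 5))) * t := by
  have hd1 : (1 : ℝ) ≤ d := by exact_mod_cast hd
  have hd0 : (0 : ℝ) ≤ d := by positivity
  have ht0 : 0 ≤ t := hb.trans hbt
  have h37 : 0 ≤ 37 * ((d : ℝ) - 1) + 4 := by linarith
  have hΓ := gradRem_nonneg hd
  have hB := fillRadius_le_of_small hd L hb hbt hct ht1
  have hB0 := fillRadius_nonneg hd L hb hc
  have hC := gradRadius_le_of_small hd L hb hc hbt hct ht1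
  have hsq := sq_le_of_small hb hbt ht1
  -- atomise
  set B : ℝ := 4 * (8 * (d : ℝ) - 7) * b + 48 * d * (L : ℝ) ^ 2 * ((2 * (d : ℝ) - 1) * c + gradRem d * b ^ 2)
    + 128 * (2 * (d : ℝ) + 1) ^ 2 * (L : ℝ) ^ 2 * ((8 * (d : ℝ) - 7) * b) ^ 2 with hBdef
  set C : ℝ := (L : ℝ) ^ 3 * (32 * d * ((8 * (d : ℝ) - 7) * b)
      * (4 * ((8 * (d : ℝ) - 7) * b)
        + (24 * d * ((2 * (d : ℝ) - 1) * c + gradRem d * b ^ 2) + 224 * ((d : ℝ) + 1) ^ 2 * ((8 * (d : ℝ) - 7) * b) ^ 2)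
        + 12 * ((2 * (d : ℝ) - 1) * c + gradRem d * b ^ 2))
    + 4 * (24 * d * ((2 * (d : ℝ) - 1) * c + gradRem d * b ^ 2) + 224 * ((d : ℝ) + 1) ^ 2 * ((8 * (d : ℝ) - 7) * b) ^ 2)
    + 24 * ((2 * (d : ℝ) - 1) * c + gradRem d * b ^ 2)) with hCdef
  set KB : ℝ := 32 * d + 48 * d * (L : ℝ) ^ 2 * (2 * (d : ℝ) + gradRem d)
    + 8192 * (d : ℝ) ^ 2 * (2 * (d : ℝ) + 1) ^ 2 * (L : ℝ) ^ 2 with hKBdef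
  set KC : ℝ := (L : ℝ) ^ 3 * (256 * (d : ℝ) ^ 2
      * (32 * d + (24 * d * (2 * (d : ℝ) + gradRem d) + 14336 * (d : ℝ) ^ 2 * ((d : ℝ) + 1) ^ 2)
        + 12 * (2 * (d : ℝ) + gradRem d))
    + 4 * (24 * d * (2 * (d : ℝ) + gradRem d) + 14336 * (d : ℝ) ^ 2 * ((d : ℝ) + 1) ^ 2)
    + 24 * (2 * (d : ℝ) + gradRem d)) with hKCdef
  set P : ℝ := 1280 * d * ((d : ℝ) + 1) ^ 2 * ((d : ℝ) + 4) ^ 2 * (L : ℝ) ^ 2 with hPdef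
  have hP0 : 0 ≤ P := by positivity
  have hKB0 : 0 ≤ KB := by positivity
  -- the three summands
  have h1 : B ^ 2 ≤ KB ^ 2 * t := by
    have h := pow_le_pow_left₀ hB0 hB 2
    calc B ^ 2 ≤ (KB * t) ^ 2 := h
      _ = KB ^ 2 * (t * t) := by ring
      _ ≤ KB ^ 2 * t := by
          apply mul_le_mul_of_nonneg_left _ (by positivity); nlinarith
  have h2 : C ≤ KC * t := hC
  have h3 : c + (37 * ((d : ℝ) - 1) + 4) * b ^ 2 ≤ (37 * ((d : ℝ) - 1) + 5) * t := by
    have := mul_le_mul_of_nonneg_left hsq h37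
    linarith
  have hdd : 0 ≤ (d : ℝ) * ((d : ℝ) + 1) := by positivity
  calc 3 * (P * B ^ 2 + d * ((d : ℝ) + 1) * C + ((d : ℝ) - 1) ^ 2 * (c + (37 * ((d : ℝ) - 1) + 4) * b ^ 2))
      ≤ 3 * (P * (KB ^ 2 * t) + d * ((d : ℝ) + 1) * (KC * t) + ((d : ℝ) - 1) ^ 2 * ((37 * ((d : ℝ) - 1) + 5) * t)) := by
        gcongr
    _ = (3 * (P * KB ^ 2 + d * ((d : ℝ) + 1) * KC + ((d : ℝ) - 1) ^ 2 * (37 * ((d : ℝ) - 1) + 5))) * t := by ring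

end

end Summit.QuantumFields.BalabanUV.T4Continuum.MinimalActionMismatchSmall
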